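import Summits.KontsevichZagierPeriods.KontsevichZagierPeriods.Theorems.SoloInformedParamRealise
import Summits.KontsevichZagierPeriods.KontsevichZagierPeriods.Theorems.SoloInformedParamCombo
import HarnessLib

/-!
# Parametrised map terms

A **map term** over the parameter space `ℝ^K` is a pair of `ℚ`-semialgebraic families
`S ⊆ ℝ^{K ⊕ Fin d}` (domains) and `G ⊆ ℝ^{K ⊕ Fin (d + e)}` (graphs of maps `ℝ^d → ℝ^e`, realised
via `Fin.append`), the vector-valued analogue of `SoloInformedPTerm` (which is the case `e = 1`
with `Fin.snoc`).  At a parameter `p` with functional graph fibre the term denotes the map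
`mval p : ℝ^d → ℝ^e`; it is `ℝ`-semialgebraic on the fibre, and `ℚ`-semialgebraic there when the
fibres are `ℚ`-semialgebraic (`isSemialgebraicMapOn_mval_of`).  Every `ℝ`-semialgebraic map on an
`ℝ`-semialgebraic set is denoted by a functional map term (`soloInformed_exists_pmap_of_mapOn`),
and functionality is a first-order (`ℚ`-semialgebraic) condition on the parameter
(`isSemialgebraic_setOf_mapFunctional`).  This is the carrier of the change-of-variables map `Φ`
in the definability of move (2).

References: [cite: BochnakCosteRoy1998, Def. 2.2.5, Prop. 2.2.4];
[cite: KontsevichZagier2001, §1.2].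
-/

noncomputable section

open Set MvPolynomial Literature.ModelTheory.ExponentialFields
  Literature.NumberTheory.Transcendental

namespace Summit.KontsevichZagierPeriods.KontsevichZagierPeriods.Theorems

/-! ### Tuple bookkeeping -/

/-- `Fin.append` is injective in both arguments. [folklore] -/
theorem soloInformed_append_eq_append_iff {α : Type*} {m n : ℕ} {x x' : Fin m → α}
    {y y' : Fin n → α} : Fin.append x y = Fin.append x' y' ↔ x = x' ∧ y = y' := by
  constructor
  · intro h
    refine ⟨funext fun i => ?_, funext fun i => ?_⟩
    · have := congrFun h (Fin.castAdd n i)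
      simpa only [Fin.append_left] using this
    · have := congrFun h (Fin.natAdd m i)
      simpa only [Fin.append_right] using this
  · rintro ⟨rfl, rfl⟩
    rfl

/-- Finite conjunctions of `ℚ`-semialgebraic conditions. [cite: BochnakCosteRoy1998, §2.1] -/
theorem soloInformed_isSemialgebraic_setOf_forall_fin {ι α : Type*} [Fintype α]
    {P : α → (ι → ℝ) → Prop} (h : ∀ a, IsSemialgebraic ℚ {u | P a u}) :
    IsSemialgebraic ℚ {u : ι → ℝ | ∀ a, P a u} := by
  have hset : {u : ι → ℝ | ∀ a, P a u} = ⋂ a ∈ (Finset.univ : Finset α), {u | P a u} := by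
    ext u
    simp only [mem_setOf_eq, Finset.mem_univ, mem_iInter, forall_true_left]
  rw [hset]
  exact IsSemialgebraic.biInter _ _ fun a _ => h a

/-- Finite disjunctions of `ℚ`-semialgebraic conditions. [cite: BochnakCosteRoy1998, §2.1] -/
theorem soloInformed_isSemialgebraic_setOf_exists_fin {ι α : Type*} [Fintype α]
    {P : α → (ι → ℝ) → Prop} (h : ∀ a, IsSemialgebraic ℚ {u | P a u}) :
    IsSemialgebraic ℚ {u : ι → ℝ | ∃ a, P a u} := by
  have hset : {u : ι → ℝ | ∃ a, P a u} = ⋃ a ∈ (Finset.univ : Finset α), {u | P a u} := by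
    ext u
    simp only [mem_setOf_eq, Finset.mem_univ, mem_iUnion, exists_true_left]
  rw [hset]
  exact IsSemialgebraic.biUnion _ _ fun a _ => h a

/-! ### Map terms -/

/-- A parametrised map term: `ℚ`-semialgebraic domain family over `ℝ^{K ⊕ Fin d}` and graph family
over `ℝ^{K ⊕ Fin (d + e)}`. [cite: BochnakCosteRoy1998, Def. 2.2.5] -/
structure SoloInformedPMap (K : Type) (d e : ℕ) : Type where
  /-- the domain family -/
  S : Set (K ⊕ Fin d → ℝ)
  /-- the graph family (`Fin.append x y`) -/
  G : Set (K ⊕ Fin (d + e) → ℝ)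
  /-- the domain family is `ℚ`-semialgebraic -/
  hS : IsSemialgebraic ℚ S
  /-- the graph family is `ℚ`-semialgebraic -/
  hG : IsSemialgebraic ℚ G

namespace SoloInformedPMap

variable {K K' : Type} {d e : ℕ} (M : SoloInformedPMap K d e) (p : K → ℝ)

/-- The domain at parameter `p`. [cite: BochnakCosteRoy1998, §2.2] -/
def fibre : Set (Fin d → ℝ) := {x | Sum.elim p x ∈ M.S}

/-- The graph at parameter `p`. [cite: BochnakCosteRoy1998, §2.2] -/
def gfibre : Set (Fin (d + e) → ℝ) := {z | Sum.elim p z ∈ M.G}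

/-- Membership in the domain fibre. [cite: BochnakCosteRoy1998, §2.2] -/
@[simp] theorem mem_fibre (x : Fin d → ℝ) : x ∈ M.fibre p ↔ Sum.elim p x ∈ M.S := Iff.rfl

/-- Membership in the graph fibre. [cite: BochnakCosteRoy1998, §2.2] -/
@[simp] theorem mem_gfibre (z : Fin (d + e) → ℝ) : z ∈ M.gfibre p ↔ Sum.elim p z ∈ M.G :=
  Iff.rfl

/-- The value read off the graph fibre. [cite: BochnakCosteRoy1998, §2.2] -/
def mval (x : Fin d → ℝ) : Fin e → ℝ :=
  Classical.epsilon fun y : Fin e → ℝ => Fin.append x y ∈ M.gfibre p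

/-- The graph fibre is the graph of a map on the domain fibre.
[cite: BochnakCosteRoy1998, §2.2] -/
def SoloInformedMapFunctional (M : SoloInformedPMap K d e) (p : K → ℝ) : Prop :=
  ∀ x ∈ M.fibre p, (∃ y : Fin e → ℝ, Fin.append x y ∈ M.gfibre p) ∧
    ∀ y y' : Fin e → ℝ, Fin.append x y ∈ M.gfibre p → Fin.append x y' ∈ M.gfibre p → y = y'

variable {M p}

/-- On a functional fibre the value is the unique point of the graph over `x`.
[cite: BochnakCosteRoy1998, §2.2] -/
theorem mval_eq (hf : M.SoloInformedMapFunctional p) {x : Fin d → ℝ} (hx : x ∈ M.fibre p)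
    {y : Fin e → ℝ} (hy : Fin.append x y ∈ M.gfibre p) : M.mval p x = y :=
  (hf x hx).2 _ _ (Classical.epsilon_spec (p := fun y : Fin e → ℝ =>
    Fin.append x y ∈ M.gfibre p) ⟨y, hy⟩) hy

/-- On a functional fibre, `(x, mval x)` is on the graph. [cite: BochnakCosteRoy1998, §2.2] -/
theorem append_mval_mem (hf : M.SoloInformedMapFunctional p) {x : Fin d → ℝ}
    (hx : x ∈ M.fibre p) : Fin.append x (M.mval p x) ∈ M.gfibre p :=
  Classical.epsilon_spec (p := fun y : Fin e → ℝ => Fin.append x y ∈ M.gfibre p) (hf x hx).1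

/-- On a functional fibre the graph fibre is the graph of `mval`.
[cite: BochnakCosteRoy1998, §2.2] -/
theorem append_mem_gfibre_iff (hf : M.SoloInformedMapFunctional p) {x : Fin d → ℝ}
    (hx : x ∈ M.fibre p) (y : Fin e → ℝ) : Fin.append x y ∈ M.gfibre p ↔ y = M.mval p x :=
  ⟨fun hy => (mval_eq hf hx hy).symm, fun hy => hy ▸ append_mval_mem hf hx⟩

variable (M p)

/-- The domain fibre is `ℝ`-semialgebraic. [cite: BochnakCosteRoy1998, §2.2] -/
theorem isSemialgebraic_fibre : IsSemialgebraic ℝ (M.fibre p) :=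
  soloInformed_isSemialgebraic_real_fibre M.hS p

/-- The graph fibre is `ℝ`-semialgebraic. [cite: BochnakCosteRoy1998, §2.2] -/
theorem isSemialgebraic_gfibre : IsSemialgebraic ℝ (M.gfibre p) :=
  soloInformed_isSemialgebraic_real_fibre M.hG p

/-- At parameters with rational fibres both fibres are `ℚ`-semialgebraic.
[cite: BochnakCosteRoy1998, Prop. 2.2.4] -/
theorem ratFibres_fibre (h : SoloInformedRatFibres p) :
    IsSemialgebraic ℚ (M.fibre p) ∧ IsSemialgebraic ℚ (M.gfibre p) :=
  ⟨h _ _ M.hS, h _ _ M.hG⟩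

variable {M p}

/-- On a functional fibre, the graph of `mval` over the fibre is the graph fibre cut to the fibre.
[cite: BochnakCosteRoy1998, §2.2] -/
theorem graph_mval_eq (hf : M.SoloInformedMapFunctional p) :
    {z : Fin (d + e) → ℝ | ∃ x ∈ M.fibre p, z = Fin.append x (M.mval p x)} =
      M.gfibre p ∩ {z | (fun i => z (Fin.castAdd e i)) ∈ M.fibre p} := by
  ext z
  simp only [mem_setOf_eq, mem_inter_iff]
  constructor
  · rintro ⟨x, hx, rfl⟩
    refine ⟨append_mval_mem hf hx, ?_⟩
    simpa only [Fin.append_left] using hx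
  · rintro ⟨hz, hx⟩
    refine ⟨_, hx, ?_⟩
    rw [mval_eq hf hx (y := fun i => z (Fin.natAdd d i)) (by rwa [Fin.append_castAdd_natAdd]),
      Fin.append_castAdd_natAdd]

/-- On a functional fibre with `k`-semialgebraic fibres, `mval` is a `k`-semialgebraic map on the
domain fibre. [cite: BochnakCosteRoy1998, §2.2] -/
theorem isSemialgebraicMapOn_mval_of {k : Type*} [CommRing k] [Algebra k ℝ]
    (hS : IsSemialgebraic k (M.fibre p)) (hG : IsSemialgebraic k (M.gfibre p))
    (hf : M.SoloInformedMapFunctional p) : IsSemialgebraicMapOn k (M.fibre p) (M.mval p) := by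
  unfold IsSemialgebraicMapOn
  rw [graph_mval_eq hf]
  exact hG.inter (hS.preimage_comp _)

/-- On a functional fibre `mval` is an `ℝ`-semialgebraic map. [cite: BochnakCosteRoy1998, §2.2] -/
theorem isSemialgebraicMapOn_mval (hf : M.SoloInformedMapFunctional p) :
    IsSemialgebraicMapOn ℝ (M.fibre p) (M.mval p) :=
  isSemialgebraicMapOn_mval_of (M.isSemialgebraic_fibre p) (M.isSemialgebraic_gfibre p) hf

/-! ### Pull-back along a map of parameter spaces -/

variable (M) in
/-- Pull-back of a map term along `θ : K → K'`. [cite: BochnakCosteRoy1998, §2.2] -/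
def pullback (θ : K → K') : SoloInformedPMap K' d e where
  S := {w | w ∘ Sum.map θ id ∈ M.S}
  G := {w | w ∘ Sum.map θ id ∈ M.G}
  hS := M.hS.preimage_comp _
  hG := M.hG.preimage_comp _

variable (M) (θ : K → K') (p' : K' → ℝ)

/-- Fibres of the pull-back. [cite: BochnakCosteRoy1998, §2.2] -/
@[simp] theorem fibre_pullback : (M.pullback θ).fibre p' = M.fibre (p' ∘ θ) := by
  ext x
  simp only [mem_fibre, pullback, mem_setOf_eq, SoloInformedPTerm.sumElim_comp_sumMap]

/-- Graph fibres of the pull-back. [cite: BochnakCosteRoy1998, §2.2] -/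
@[simp] theorem gfibre_pullback : (M.pullback θ).gfibre p' = M.gfibre (p' ∘ θ) := by
  ext z
  simp only [mem_gfibre, pullback, mem_setOf_eq, SoloInformedPTerm.sumElim_comp_sumMap]

/-- Values of the pull-back. [cite: BochnakCosteRoy1998, §2.2] -/
@[simp] theorem mval_pullback : (M.pullback θ).mval p' = M.mval (p' ∘ θ) := by
  funext x
  simp only [mval, gfibre_pullback]

/-- Functionality is invariant under pull-back. [cite: BochnakCosteRoy1998, §2.2] -/
theorem mapFunctional_pullback_iff :
    (M.pullback θ).SoloInformedMapFunctional p' ↔ M.SoloInformedMapFunctional (p' ∘ θ) := by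
  simp only [SoloInformedMapFunctional, fibre_pullback, gfibre_pullback]

end SoloInformedPMap

/-! ### Realisation of semialgebraic maps -/

/-- Joining a domain family over `K₁` and a graph family over `K₂` into a map term over `K₁ ⊕ K₂`.
[cite: BochnakCosteRoy1998, Def. 2.2.5] -/
def soloInformedJoinMap {K₁ K₂ : Type} {d e : ℕ} (S : Set (K₁ ⊕ Fin d → ℝ))
    (G : Set (K₂ ⊕ Fin (d + e) → ℝ)) (hS : IsSemialgebraic ℚ S) (hG : IsSemialgebraic ℚ G) :
    SoloInformedPMap (K₁ ⊕ K₂) d e where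
  S := {w | w ∘ Sum.map Sum.inl id ∈ S}
  G := {w | w ∘ Sum.map Sum.inr id ∈ G}
  hS := hS.preimage_comp _
  hG := hG.preimage_comp _

/-- **Every real semialgebraic map on a real semialgebraic set is denoted by a functional map
term.** [cite: BochnakCosteRoy1998, Def. 2.2.5] -/
theorem soloInformed_exists_pmap_of_mapOn {d e : ℕ} {s : Set (Fin d → ℝ)}
    {Φ : (Fin d → ℝ) → (Fin e → ℝ)} (hs : IsSemialgebraic ℝ s) (hΦ : IsSemialgebraicMapOn ℝ s Φ) :
    ∃ (K : Type) (_ : Fintype K) (M : SoloInformedPMap K d e) (p₀ : K → ℝ),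
      M.SoloInformedMapFunctional p₀ ∧ M.fibre p₀ = s ∧
      (∀ x ∈ s, ∀ y, Fin.append x y ∈ M.gfibre p₀ ↔ y = Φ x) ∧ ∀ x ∈ s, M.mval p₀ x = Φ x := by
  obtain ⟨K₁, _, S, p₁, hS, hSfib⟩ := soloInformed_ratFamilyFibre_of_isSemialgebraic hs
  obtain ⟨K₂, _, G, p₂, hG, hGfib⟩ := soloInformed_ratFamilyFibre_of_isSemialgebraic hΦ
  have hfib : (soloInformedJoinMap S G hS hG).fibre (Sum.elim p₁ p₂) = s := by
    rw [← hSfib]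
    ext x
    simp only [SoloInformedPMap.mem_fibre, soloInformedJoinMap, mem_setOf_eq,
      SoloInformedPTerm.sumElim_comp_sumMap, Sum.elim_comp_inl]
  have hgraph : ∀ x ∈ s, ∀ y,
      Fin.append x y ∈ (soloInformedJoinMap S G hS hG).gfibre (Sum.elim p₁ p₂) ↔ y = Φ x := by
    intro x hx y
    have hG' : (soloInformedJoinMap S G hS hG).gfibre (Sum.elim p₁ p₂) =
        {z | Sum.elim p₂ z ∈ G} := by
      ext z
      simp only [SoloInformedPMap.mem_gfibre, soloInformedJoinMap, mem_setOf_eq,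
        SoloInformedPTerm.sumElim_comp_sumMap, Sum.elim_comp_inr]
    rw [hG', hGfib]
    simp only [mem_setOf_eq]
    constructor
    · rintro ⟨x', -, h⟩
      obtain ⟨rfl, rfl⟩ := soloInformed_append_eq_append_iff.1 h
      rfl
    · rintro rfl
      exact ⟨x, hx, rfl⟩
  have hfun : (soloInformedJoinMap S G hS hG).SoloInformedMapFunctional (Sum.elim p₁ p₂) := by
    intro x hx
    rw [hfib] at hx
    exact ⟨⟨Φ x, (hgraph x hx _).2 rfl⟩, fun y y' hy hy' => by
      rw [(hgraph x hx y).1 hy, (hgraph x hx y').1 hy']⟩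
  refine ⟨K₁ ⊕ K₂, inferInstance, soloInformedJoinMap S G hS hG, Sum.elim p₁ p₂, hfun, hfib,
    hgraph, fun x hx => ?_⟩
  exact SoloInformedPMap.mval_eq hfun (hfib.symm ▸ hx) ((hgraph x hx _).2 rfl)

/-! ### Functionality is first-order -/

namespace SoloInformedPMap

variable {K : Type} {d e : ℕ}

/-- Index map reading the graph point `(x, w ∘ c)` off the block tuple `((p, x), w)`.
[cite: BochnakCosteRoy1998, Prop. 2.2.4] -/
def soloAppIdx (K : Type) (d e : ℕ) {β : Type} (c : Fin e → β) :
    K ⊕ Fin (d + e) → (K ⊕ Fin d) ⊕ β :=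
  Sum.elim (fun k => Sum.inl (Sum.inl k)) (Fin.append (fun i => Sum.inl (Sum.inr i)) (fun j =>
    Sum.inr (c j)))

/-- Reading the graph point off the block tuple. [cite: BochnakCosteRoy1998, Prop. 2.2.4] -/
theorem sumElim_comp_soloAppIdx {β : Type} (c : Fin e → β) (p : K → ℝ) (x : Fin d → ℝ)
    (w : β → ℝ) :
    Sum.elim (Sum.elim p x) w ∘ soloAppIdx K d e c = Sum.elim p (Fin.append x (w ∘ c)) := by
  funext i
  rcases i with k | i
  · rfl
  · refine Fin.addCases (fun j => ?_) (fun j => ?_) i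
    · simp only [soloAppIdx, Function.comp_apply, Sum.elim_inr, Fin.append_left, Sum.elim_inl]
    · simp only [soloAppIdx, Function.comp_apply, Sum.elim_inr, Fin.append_right]

/-- Membership form of `sumElim_comp_soloAppIdx`. [cite: BochnakCosteRoy1998, Prop. 2.2.4] -/
theorem comp_soloAppIdx_mem_iff (M : SoloInformedPMap K d e) {β : Type} (c : Fin e → β)
    (p : K → ℝ) (x : Fin d → ℝ) (w : β → ℝ) :
    Sum.elim (Sum.elim p x) w ∘ soloAppIdx K d e c ∈ M.G ↔
      Fin.append x (w ∘ c) ∈ M.gfibre p := by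
  rw [sumElim_comp_soloAppIdx]
  rfl

/-- Functionality of the graph fibre is a `ℚ`-semialgebraic condition on the parameter.
[cite: BochnakCosteRoy1998, Prop. 2.2.4] -/
theorem isSemialgebraic_setOf_mapFunctional [Finite K] (M : SoloInformedPMap K d e) :
    IsSemialgebraic ℚ {p : K → ℝ | M.SoloInformedMapFunctional p} := by
  -- existence block: `w : Fin e → ℝ`
  have hE : IsSemialgebraic ℚ {u : (K ⊕ Fin d) ⊕ Fin e → ℝ |
      u ∘ soloAppIdx K d e (id : Fin e → Fin e) ∈ M.G} := M.hG.preimage_comp _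
  -- uniqueness block: `w : Fin e ⊕ Fin e → ℝ`
  have hU : IsSemialgebraic ℚ {u : (K ⊕ Fin d) ⊕ (Fin e ⊕ Fin e) → ℝ |
      u ∘ soloAppIdx K d e (Sum.inl : Fin e → Fin e ⊕ Fin e) ∈ M.G →
      u ∘ soloAppIdx K d e (Sum.inr : Fin e → Fin e ⊕ Fin e) ∈ M.G →
      ∀ i : Fin e, u (Sum.inr (Sum.inl i)) = u (Sum.inr (Sum.inr i))} :=
    soloInformed_isSemialgebraic_setOf_imp (M.hG.preimage_comp _)
      (soloInformed_isSemialgebraic_setOf_imp (M.hG.preimage_comp _)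
        (soloInformed_isSemialgebraic_setOf_forall_fin fun i =>
          soloInformed_isSemialgebraic_setOf_coord_eq _ _))
  have hB : IsSemialgebraic ℚ {u : K ⊕ Fin d → ℝ | u ∈ M.S →
      (∃ w : Fin e → ℝ, Sum.elim u w ∈ {u : (K ⊕ Fin d) ⊕ Fin e → ℝ |
        u ∘ soloAppIdx K d e (id : Fin e → Fin e) ∈ M.G}) ∧
      ∀ w : Fin e ⊕ Fin e → ℝ, Sum.elim u w ∈ {u : (K ⊕ Fin d) ⊕ (Fin e ⊕ Fin e) → ℝ |
        u ∘ soloAppIdx K d e (Sum.inl : Fin e → Fin e ⊕ Fin e) ∈ M.G →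
        u ∘ soloAppIdx K d e (Sum.inr : Fin e → Fin e ⊕ Fin e) ∈ M.G →
        ∀ i : Fin e, u (Sum.inr (Sum.inl i)) = u (Sum.inr (Sum.inr i))}} :=
    soloInformed_isSemialgebraic_setOf_imp M.hS
      (soloInformed_isSemialgebraic_setOf_and
        (soloInformed_isSemialgebraic_setOf_exists_block hE fun _ => Iff.rfl)
        (soloInformed_isSemialgebraic_setOf_forall_block hU fun _ => Iff.rfl))
  refine soloInformed_isSemialgebraic_setOf_forall_fibre hB fun p x => ?_
  simp only [mem_setOf_eq, comp_soloAppIdx_mem_iff, Sum.elim_inr, mem_fibre, Function.comp_id]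
  refine ⟨fun h hx => ⟨(h hx).1, fun w h₁ h₂ => ?_⟩, fun h hx => ⟨(h hx).1, fun y y' h₁ h₂ => ?_⟩⟩
  · exact funext_iff.1 ((h hx).2 _ _ h₁ h₂)
  · have := (h hx).2 (Sum.elim y y') (by simpa only [Sum.elim_comp_inl] using h₁)
      (by simpa only [Sum.elim_comp_inr] using h₂)
    exact funext fun i => by simpa using this i

end SoloInformedPMap

end Summit.KontsevichZagierPeriods.KontsevichZagierPeriods.Theorems
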